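import Literature.Analysis.FunctionSpaces.LittlewoodPaleyConvergenceProofs
import Literature.Analysis.UnboundedOperators.HeatSemigroupProofs
import Literature.Analysis.UnboundedOperators.HeatSemigroupStrongContinuityProofs
import Mathlib.Analysis.SpecialFunctions.Integrals.Basic
import HarnessLib

/-!
# Negative-regularity Besov norms control pairings with Schwartz functions

Analysis/FunctionSpaces support file (all results proved). For `σ > 0` (`σ < 2`), `1 ≤ p ≤ ∞`
and a Schwartz function `θ`, there is a constant `K = K(p, σ, θ)` such that every tempered
distribution `W ∈ 𝓢'_h` (realisation condition `Ṡ_j W → 0` as `j → -∞`, the clause of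
`Literature.Analysis.FunctionSpaces.MemHomBesov`) satisfies

  `‖⟨W, θ⟩‖ ≤ K ‖W‖_{Ḃ^{-σ}_{p,∞}}`   (`exists_nnnorm_apply_le_mul_eHomBesovNorm`),

i.e. the homogeneous Besov spaces of negative regularity embed continuously into `𝓢'` (Bahouri–
Chemin–Danchin 2011, Prop. 2.27 / Rem. 2.26: `Ḃ^s_{p,r} ↪ 𝓢'_h` for `s < d/p`; here the
negative-index case). Consequences used by the Navier–Stokes files (`FluidPDE/CriticalRegularity`,
the class `ContinuousInHomBesovOn`): continuity in `Ḃ^{s_p}_{p,q}` of a family of distributions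
implies continuity of all its pairings with Schwartz functions, and Besov limits of uniformly
bounded functions are bounded.

## Proof (through the heat flow)

Instead of the Littlewood–Paley series we use the **heat characterisation** already proved in
the tree (`exists_eLpNormDistrib_heatSemigroup_le_rpow_mul_eHomBesovNorm`, BCD Thm. 2.34 /
GKP 2016 App. B): `‖e^{sΔ}W‖_{L^p} ≤ C s^{-σ/2} ‖W‖_{Ḃ^{-σ}_{p,∞}}` for `W ∈ 𝓢'_h`. The function
`g(s) = ⟨e^{sΔ}W, θ⟩` is continuous on `[0, ∞)` (strong continuity of the heat semigroup on `𝓢`,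
`SchwartzMap.continuous_heatSemigroup_apply`, transposed), differentiable on `(0, ∞)` with
`g'(s) = ⟨Δ e^{sΔ}W, θ⟩ = ⟨e^{sΔ}W, Δθ⟩` (`TemperedDistribution.hasDerivAt_heatSemigroup_holds`),
and by Hölder `‖g(s)‖ ≤ C s^{-σ/2} ‖W‖_Ḃ ‖θ‖_{L^{p'}}`, `‖g'(s)‖ ≤ C s^{-σ/2} ‖W‖_Ḃ ‖Δθ‖_{L^{p'}}`.
Hence `‖g(ε)‖ ≤ ‖g(1)‖ + ∫_ε^1 ‖g'‖ ≤ C ‖W‖_Ḃ (‖θ‖_{p'} + ‖Δθ‖_{p'}/(1 - σ/2))` for all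
`0 < ε < 1` (`σ < 2`), and `ε → 0⁺` gives the claim.

## References

* H. Bahouri, J.-Y. Chemin, R. Danchin, *Fourier Analysis and Nonlinear PDE* (2011), Def. 1.26,
  Prop. 2.27, Thm. 2.34. [BahouriCheminDanchin2011]
* I. Gallagher, G. S. Koch, F. Planchon, Comm. Math. Phys. 343 (2016), App. B. [GKP2016]
-/

noncomputable section

open MeasureTheory SchwartzMap Filter Function Set intervalIntegral
open _root_.Topology
open scoped SchwartzMap ENNReal NNReal FourierTransform Laplacian

namespace Literature.Analysis.FunctionSpaces

variable {E : Type*} [NormedAddCommGroup E] [InnerProductSpace ℝ E] [FiniteDimensional ℝ E]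
  [MeasurableSpace E] [BorelSpace E] {F : Type*} [NormedAddCommGroup F] [NormedSpace ℂ F]
  [CompleteSpace F]

/-! ### Hölder's inequality for pairings of `L^p` classes with Schwartz functions -/

/-- **Hölder for the pairing `⟨f, ζ⟩ = ∫ ζ • f`** of `f ∈ L^p(E; F)` with a Schwartz function:
`‖⟨f, ζ⟩‖ ≤ ‖ζ‖_{L^{p'}} ‖f‖_{L^p}`. [folklore] -/
theorem norm_coe_Lp_apply_le {p q : ℝ≥0∞} [Fact (1 ≤ p)] [hpq : q.HolderConjugate p]
    (f : Lp F p (volume : Measure E)) (ζ : 𝓢(E, ℂ)) :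
    ‖(f : 𝓢'(E, F)) ζ‖ ≤ (eLpNorm (⇑ζ) q volume * eLpNorm (f : E → F) p volume).toReal := by
  have e : (f : 𝓢'(E, F)) ζ = ∫ x, ζ x • (f : E → F) x := Lp.toTemperedDistribution_apply f ζ
  rw [e]
  have hζm : AEStronglyMeasurable (⇑ζ) (volume : Measure E) := ζ.continuous.aestronglyMeasurable
  have hfm : AEStronglyMeasurable (f : E → F) volume := Lp.aestronglyMeasurable f
  have h1 : eLpNorm (fun x => ζ x • (f : E → F) x) 1 volume ≤
      eLpNorm (⇑ζ) q volume * eLpNorm (f : E → F) p volume :=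
    eLpNorm_smul_le_mul_eLpNorm (p := q) (q := p) (r := 1) hfm hζm
  have hfin : eLpNorm (⇑ζ) q volume * eLpNorm (f : E → F) p volume < ⊤ :=
    ENNReal.mul_lt_top (ζ.eLpNorm_lt_top q volume) (Lp.memLp f).eLpNorm_lt_top
  have hsm : AEStronglyMeasurable (fun x => ζ x • (f : E → F) x) volume := hζm.smul hfm
  calc ‖∫ x, ζ x • (f : E → F) x‖ ≤ ∫ x, ‖ζ x • (f : E → F) x‖ := norm_integral_le_integral_norm _
    _ = (eLpNorm (fun x => ζ x • (f : E → F) x) 1 volume).toReal := by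
        rw [integral_norm_eq_lintegral_enorm hsm, eLpNorm_one_eq_lintegral_enorm]
    _ ≤ _ := ENNReal.toReal_mono hfin.ne h1

/-- The same for a distribution of finite `L^p` norm (`eLpNormDistrib`): `‖u ζ‖ ≤ ‖ζ‖_{L^{p'}} ‖u‖_{L^p}`.
[folklore] -/
theorem norm_apply_le_of_eLpNormDistrib_lt_top {p q : ℝ≥0∞} [Fact (1 ≤ p)] [q.HolderConjugate p]
    {u : 𝓢'(E, F)} (hu : eLpNormDistrib p u < ⊤) (ζ : 𝓢(E, ℂ)) :
    ‖u ζ‖ ≤ (eLpNorm (⇑ζ) q volume * eLpNormDistrib p u).toReal := by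
  obtain ⟨f, hf⟩ := exists_coe_eq_of_eLpNormDistrib_lt_top hu
  rw [← hf, eLpNormDistrib_coe, Lp.enorm_def]
  exact norm_coe_Lp_apply_le f ζ

/-! ### The heat-flow pairing `s ↦ ⟨e^{sΔ} W, θ⟩` -/

omit [CompleteSpace F] in
/-- `⟨e^{sΔ}W, θ⟩ = ⟨W, 𝓕(h_s • 𝓕⁻¹θ)⟩` (transpose formula of the Fourier multiplier; definitional).
[folklore] -/
theorem heatSemigroup_apply_apply (s : ℝ) (W : 𝓢'(E, F)) (θ : 𝓢(E, ℂ)) :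
    TemperedDistribution.heatSemigroup s W θ =
      W (𝓕 (smulLeftCLM ℂ (fun ξ : E => (UnboundedOperators.heatSymbol s ξ : ℂ)) (𝓕⁻ θ))) :=
  rfl

omit [CompleteSpace F] in
/-- **Continuity of `s ↦ ⟨e^{sΔ}W, θ⟩` on `[0, ∞)`** (strong continuity of the multiplication
semigroup `h_s •` on `𝓢`, `SchwartzMap.continuous_smulLeftCLM_heatSymbol`, composed with the
continuous maps `𝓕` and `W`). [folklore] -/
theorem continuousOn_heatSemigroup_apply_apply (W : 𝓢'(E, F)) (θ : 𝓢(E, ℂ)) :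
    ContinuousOn (fun s : ℝ => TemperedDistribution.heatSemigroup s W θ) (Ici 0) := by
  have hG : Continuous fun r : ℝ≥0 =>
      W (𝓕 (smulLeftCLM ℂ (fun ξ : E => (UnboundedOperators.heatSymbol (r : ℝ) ξ : ℂ)) (𝓕⁻ θ))) :=
    W.continuous.comp (FourierTransform.continuous_fourier.comp
      (SchwartzMap.continuous_smulLeftCLM_heatSymbol (𝓕⁻ θ)))
  have heq : EqOn (fun s : ℝ => TemperedDistribution.heatSemigroup s W θ)
      ((fun r : ℝ≥0 => W (𝓕 (smulLeftCLM ℂ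
        (fun ξ : E => (UnboundedOperators.heatSymbol (r : ℝ) ξ : ℂ)) (𝓕⁻ θ)))) ∘ Real.toNNReal)
      (Ici 0) := fun s hs => by
    simp only [Function.comp_apply, heatSemigroup_apply_apply, Real.coe_toNNReal _ hs]
  exact (hG.comp continuous_real_toNNReal).continuousOn.congr heq

/-- **The Besov norm of negative regularity controls pairings with Schwartz functions**
(BCD Prop. 2.27 / Rem. 2.26, the embedding `Ḃ^{-σ}_{p,∞} ∩ 𝓢'_h ↪ 𝓢'`; heat-flow proof, see the
module docstring): for `0 < σ < 2`, `1 ≤ p ≤ ∞` with conjugate exponent `q`, and `θ ∈ 𝓢`, there is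
`K` with `‖⟨W, θ⟩‖ ≤ K ‖W‖_{Ḃ^{-σ}_{p,∞}}` for every `W` with `Ṡ_j W → 0` (`j → -∞`).
[cite: BahouriCheminDanchin2011, Prop. 2.27] -/
theorem exists_nnnorm_apply_le_mul_eHomBesovNorm (p q : ℝ≥0∞) [Fact (1 ≤ p)]
    [q.HolderConjugate p] {σ : ℝ} (hσ : 0 < σ) (hσ2 : σ < 2) (θ : 𝓢(E, ℂ)) :
    ∃ K : ℝ≥0, ∀ W : 𝓢'(E, F), Tendsto (fun j : ℤ => lowFreqCutoff j W) atBot (𝓝 0) →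
      (‖W θ‖₊ : ℝ≥0∞) ≤ K * eHomBesovNorm (-σ) p ∞ W := by
  obtain ⟨C, hC⟩ :=
    exists_eLpNormDistrib_heatSemigroup_le_rpow_mul_eHomBesovNorm (E := E) (F := F) p hσ
  -- the constants
  set A : ℝ := (eLpNorm (⇑θ) q (volume : Measure E)).toReal with hA
  set B : ℝ := (eLpNorm ((Δ θ : 𝓢(E, ℂ)) : E → ℂ) q (volume : Measure E)).toReal with hB
  set D : ℝ := 1 / (1 - σ / 2) with hD
  have hA0 : 0 ≤ A := ENNReal.toReal_nonneg
  have hB0 : 0 ≤ B := ENNReal.toReal_nonneg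
  have hD0 : 0 < D := by rw [hD]; exact one_div_pos.2 (by linarith)
  set K : ℝ := C * A + C * B * D + 1 with hK
  have hK0 : 0 < K := by positivity
  set Kn : ℝ≥0 := ⟨K, hK0.le⟩ with hKn
  have hKn0 : (Kn : ℝ≥0∞) ≠ 0 := by
    rw [hKn, ne_eq, ENNReal.coe_eq_zero, ← NNReal.coe_eq_zero]
    exact hK0.ne'
  have hKnK : ENNReal.ofReal K = (Kn : ℝ≥0∞) := by
    rw [hKn, ENNReal.ofReal_eq_coe_nnreal hK0.le]
    rfl
  refine ⟨Kn, fun W hW => ?_⟩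
  set N : ℝ≥0∞ := eHomBesovNorm (-σ) p ∞ W with hN
  rcases eq_or_lt_of_le (le_top : N ≤ ⊤) with hNtop | hNtop
  · rw [hNtop, ENNReal.mul_top hKn0]
    exact le_top
  -- the real form of the claim
  suffices hreal : ‖W θ‖ ≤ K * N.toReal by
    have h1 : (‖W θ‖₊ : ℝ≥0∞) = ENNReal.ofReal ‖W θ‖ := (ofReal_norm _).symm
    rw [h1]
    calc ENNReal.ofReal ‖W θ‖ ≤ ENNReal.ofReal (K * N.toReal) := ENNReal.ofReal_le_ofReal hreal
      _ = ENNReal.ofReal K * N := by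
          rw [ENNReal.ofReal_mul hK0.le, ENNReal.ofReal_toReal hNtop.ne]
      _ = (Kn : ℝ≥0∞) * N := by rw [hKnK]
  -- `L^p` bounds along the heat flow
  have hLp : ∀ s : ℝ, 0 < s → eLpNormDistrib p (TemperedDistribution.heatSemigroup s W) ≤
      C * ENNReal.ofReal (s ^ (-σ / 2)) * N := fun s hs => hC s hs W hW
  have hLp_top : ∀ s : ℝ, 0 < s → eLpNormDistrib p (TemperedDistribution.heatSemigroup s W) < ⊤ :=
    fun s hs => (hLp s hs).trans_lt (ENNReal.mul_lt_top
      (ENNReal.mul_lt_top ENNReal.coe_lt_top ENNReal.ofReal_lt_top) hNtop)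
  have hpair : ∀ (ζ : 𝓢(E, ℂ)) (s : ℝ), 0 < s →
      ‖TemperedDistribution.heatSemigroup s W ζ‖ ≤
        (eLpNorm (⇑ζ) q (volume : Measure E)).toReal * (C * s ^ (-σ / 2) * N.toReal) := by
    intro ζ s hs
    refine (norm_apply_le_of_eLpNormDistrib_lt_top (q := q) (hLp_top s hs) ζ).trans ?_
    rw [ENNReal.toReal_mul]
    refine mul_le_mul_of_nonneg_left ?_ ENNReal.toReal_nonneg
    have h := ENNReal.toReal_mono (ENNReal.mul_ne_top (ENNReal.mul_ne_top ENNReal.coe_ne_top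
      ENNReal.ofReal_ne_top) hNtop.ne) (hLp s hs)
    rwa [ENNReal.toReal_mul, ENNReal.toReal_mul, ENNReal.coe_toReal,
      ENNReal.toReal_ofReal (Real.rpow_nonneg hs.le _)] at h
  -- the pairing function and its derivative
  set g : ℝ → F := fun s => TemperedDistribution.heatSemigroup s W θ with hg
  set g' : ℝ → F := fun s => TemperedDistribution.heatSemigroup s W (Δ θ) with hg'
  have hgc : ContinuousOn g (Ici 0) := continuousOn_heatSemigroup_apply_apply W θ
  have hg'c : ContinuousOn g' (Ici 0) := continuousOn_heatSemigroup_apply_apply W (Δ θ)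
  have hder : ∀ s : ℝ, 0 < s → HasDerivAt g (g' s) s := fun s hs => by
    have h := TemperedDistribution.hasDerivAt_heatSemigroup_holds (E := E) (F := F) hs W θ
    rw [TemperedDistribution.laplacian_apply_apply] at h
    exact h
  have hg1 : ‖g 1‖ ≤ A * (C * N.toReal) := by
    have h := hpair θ 1 one_pos
    rw [Real.one_rpow, mul_one] at h
    exact h
  -- the bound for `0 < ε < 1`
  have hbound : ∀ ε : ℝ, 0 < ε → ε < 1 → ‖g ε‖ ≤ K * N.toReal := by
    intro ε hε hε1
    have hsub : uIcc ε 1 ⊆ Ici 0 := by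
      rw [uIcc_of_le hε1.le]
      exact fun s hs => hε.le.trans hs.1
    have hFTC : ∫ s in ε..1, g' s = g 1 - g ε :=
      integral_eq_sub_of_hasDerivAt (fun s hs => hder s (hε.trans_le (by
        rw [uIcc_of_le hε1.le] at hs; exact hs.1)))
        ((hg'c.mono hsub).intervalIntegrable)
    have hint_bound : ‖∫ s in ε..1, g' s‖ ≤ ∫ s in ε..1, B * (C * s ^ (-σ / 2) * N.toReal) := by
      refine norm_integral_le_of_norm_le hε1.le (ae_of_all _ fun s hs => ?_) ?_
      · exact hpair (Δ θ) s (hε.trans hs.1)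
      · refine (ContinuousOn.intervalIntegrable ?_)
        refine ContinuousOn.mul continuousOn_const (ContinuousOn.mul ?_ continuousOn_const)
        refine continuousOn_const.mul (ContinuousOn.rpow_const continuousOn_id fun s hs => Or.inl ?_)
        rw [uIcc_of_le hε1.le] at hs
        exact (hε.trans_le hs.1).ne'
    have hrpow : ∫ s in ε..1, s ^ (-σ / 2) ≤ D := by
      rw [integral_rpow (Or.inl (by linarith : (-1 : ℝ) < -σ / 2))]
      rw [Real.one_rpow, hD]
      have h1 : 0 < -σ / 2 + 1 := by linarith
      have h2 : 0 ≤ ε ^ (-σ / 2 + 1) := Real.rpow_nonneg hε.le _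
      rw [div_le_div_iff₀ h1 (by linarith), one_mul]
      nlinarith
    have hint2 : ∫ s in ε..1, B * (C * s ^ (-σ / 2) * N.toReal) ≤ B * (C * D * N.toReal) := by
      have e : (fun s : ℝ => B * (C * s ^ (-σ / 2) * N.toReal)) =
          fun s => (B * C * N.toReal) * s ^ (-σ / 2) := by
        funext s; ring
      rw [e, intervalIntegral.integral_const_mul]
      calc B * C * N.toReal * ∫ s in ε..1, s ^ (-σ / 2) ≤ B * C * N.toReal * D :=
            mul_le_mul_of_nonneg_left hrpow (by positivity)
        _ = B * (C * D * N.toReal) := by ring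
    calc ‖g ε‖ = ‖g 1 - (g 1 - g ε)‖ := by rw [sub_sub_cancel]
      _ ≤ ‖g 1‖ + ‖g 1 - g ε‖ := norm_sub_le _ _
      _ = ‖g 1‖ + ‖∫ s in ε..1, g' s‖ := by rw [hFTC]
      _ ≤ A * (C * N.toReal) + B * (C * D * N.toReal) := add_le_add hg1 (hint_bound.trans hint2)
      _ ≤ K * N.toReal := by
          rw [hK]
          have : 0 ≤ N.toReal := ENNReal.toReal_nonneg
          nlinarith
  -- `ε → 0⁺`
  have hlim : Tendsto g (𝓝[>] 0) (𝓝 (g 0)) :=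
    ((hgc 0 (mem_Ici.2 le_rfl)).mono_left (nhdsWithin_mono _ fun s hs => le_of_lt (mem_Ioi.1 hs)))
  have hg0 : g 0 = W θ := by
    simp only [hg, TemperedDistribution.heatSemigroup_zero]
    rfl
  rw [← hg0]
  refine le_of_tendsto ((continuous_norm.tendsto _).comp hlim) ?_
  filter_upwards [Ioo_mem_nhdsGT (zero_lt_one' ℝ)] with ε hε
  exact hbound ε hε.1 hε.2

end Literature.Analysis.FunctionSpaces

end
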